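import Literature.AlgebraicGeometry.GroupSchemes.PreimageRankOfLiftable        -- ★ p849894∕p849907 `finrank_alg_eq_ker_mul_of_liftable` (+ ★ (KR), ★ `isMonHom_of_comp_mono`, ★ `GroupSchemeKernel`)
import Literature.AlgebraicGeometry.GroupSchemes.BTGroupUniformizerKernelRank   -- ★ `AffineGroupScheme.Alg.finrank_eq_of_iso`, ★ `exists_iso_of_fac_of_fac`
import HarnessLib

/-!
# Coprime splitting of ideal torsion: a finite group scheme killed by `𝔞𝔟`, `𝔞 + 𝔟 = (1)`, has `rk Γ(K) = rk Γ(K[𝔞]) · rk Γ(K[𝔟])`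
# ([Tate 1967] §2.2; [Tate 1997] (1.6)–(1.7), §(3.7); [Neukirch 1999] I (3.6); [Görtz–Wedhorn 2020] Def. 4.45 (2))

Topic `Literature/AlgebraicGeometry/GroupSchemes`; namespace `Literature.AlgebraicGeometry.GroupSchemes.IdealTorsionCoprimeSplitting`.  THEOREMS ONLY (no
definition, no named fact, no instance, no notation, no `sorry`).  Cell `hodgecm-mathlib` (D-0151), FLOOR 0, P6 «MOD programme» (crux hLiu418 =
stmt-HodgeConjecture-24832, `--supports`, count-neutral), half-A line L3 (socket `stub_ROOF0`; (rL-asm) `w`-block), organ **(ρ-deg)(ii) «CRT BLOCK COUNT»**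
(LA1-plan (g3) deal 2026-09-02T06:47Z «`rk Ker q̄ = rk (Ker q̄ ∩ W) · rk (Ker q̄ ∩ 𝒢l)` under hker-DOWN»; pen LA1-p01 (g3); currency word LA3-p03 (g3)
06:47:36Z: ranks as `Module.finrank k (Alg X)`, closed subgroups as a monomorphism + all-`T` points law, the ring action with the W-DOCK laws `hβ1 ∕ hβadd ∕ hβmul`).
GENERIC: the L3 instance (`K := Ker q̄`, `𝔞 := 𝔭_w`, `𝔟 := 𝔭_{c•w}`, hker-DOWN by value) is a row of the consumer's pack.  HONEST LABEL: HC_CM is proved only modulo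
the 7 printed citations (2 remaining: hLiu418 = stmt-HodgeConjecture-24832, h413 = stmt-HodgeConjecture-24833) until rung 0 closes; this file is generic and discharges
none of them.

THE MATHEMATICS.  `k` a field, `K` an affine `k`-group scheme with `Γ(K)` finite over `k`, `O` a commutative ring acting on `K` by endomorphisms `βK : O → End K`
(`βK 1 = 𝟙`, `βK (a + b) = βK a · βK b` pointwise, `βK (a b) = βK b ≫ βK a` — the conventions of ★ `TorsionLayerBlockIdempotents` ∕ ★ `RingAction`), ideals
`𝔞, 𝔟 ⊆ O` with `𝔞 𝔟` KILLING `K` (`βK c = 1` for `c ∈ 𝔞𝔟`), and closed subgroups `ι𝔞 : K[𝔞] ↪ K`, `ι𝔟 : K[𝔟] ↪ K` whose `T`-points are the points of `K` killed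
by `βK(𝔞)` resp. `βK(𝔟)`.  Let `e ∈ O` be a CRT element: `e ≡ 1 (mod 𝔞)`, `e ∈ 𝔟` ([Neukirch1999] I (3.6); it exists iff `𝔞 + 𝔟 = (1)`).  Then for a `T`-point
`x` of `K`:  (§1) `x` is `𝔞`-torsion ⟺ `x ≫ βK e = x` («⇐»: `βK a ∘ βK e = βK(ae)`, `ae ∈ 𝔞𝔟`; «⇒»: `𝟙 = βK(1−e)·βK e` and `1 − e ∈ 𝔞`), and `x` is
`𝔟`-torsion ⟺ `x ≫ βK e = 1` («⇒»: `e ∈ 𝔟`; «⇐»: `b = b(1−e) + be`, `b(1−e) ∈ 𝔞𝔟`, `βK(be) = βK e ≫ βK b`) — [Tate1967] §2.2 (the CRT idempotents of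
`O ⊗ ℤ_p` split the layers), [Tate1997FiniteFlatGroupSchemes] (1.6)–(1.7) (subgroups by their `T`-points).  (§2) Hence `βK e` lands in `K[𝔞]`: there is a
PROJECTION `π : K → K[𝔞]` with `π ≫ ι𝔞 = βK e`, a homomorphism SPLIT by `ι𝔞` (`ι𝔞 ≫ π = 𝟙`), so every `T`-point of `K[𝔞]` lifts to `K` along `π` with NO cover
(`π` is fppf-liftable in the sense of ★ `PreimageRankOfLiftable`), and `Ker π` has exactly the `T`-points of `K[𝔟]` (§1), so `Ker π ≅ K[𝔟]` over `k`.  (§3) The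
kernel–rank law for liftable homomorphisms (★ `finrank_alg_eq_ker_mul_of_liftable`; [Tate1997FiniteFlatGroupSchemes] §(3.7) «the order is multiplicative»,
[Waterhouse1979] §14.1) gives **`rk Γ(K) = rk Γ(K[𝔞]) · rk Γ(K[𝔟])`** — equivalently `K ≅ K[𝔞] × K[𝔟]`, the coprime (CRT) splitting of `𝔞𝔟`-torsion.

* §1 (points; `e` BY VALUE, `he𝔞 : e - 1 ∈ 𝔞`, `he𝔟 : e ∈ 𝔟`) `comp_crt_eq_self_of_torsion`, `torsion_of_comp_crt_eq_self`, **`comp_crt_eq_self_iff`** (`𝔞`-torsion ⟺ fixed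
  by `βK e`); `torsion_of_comp_crt_eq_one`, **`comp_crt_eq_one_iff`** (`𝔟`-torsion ⟺ killed by `βK e`); `crt_comp_crt` (`βK e` is idempotent); `sup_eq_top_of_crt`,
  `exists_crt_of_sup_eq_top` (the CRT element ⟺ `𝔞 ⊔ 𝔟 = ⊤`).
* §2 (the projection) **`exists_proj`** (`∃ π : K ⟶ K[𝔞], π ≫ ι𝔞 = βK e`), `ι_comp_crt` (`ι𝔞 ≫ βK e = ι𝔞`), `ι_comp_proj` (`ι𝔞 ≫ π = 𝟙`), `isMonHom_proj`,
  `liftable_proj`, `comp_proj_eq_one_iff` (`y ≫ π = 1 ⟺ y` is `𝔟`-torsion), **`exists_iso_ker_proj`** (`Ker π ≅ K[𝔟]` over `K`).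
* §3 HEADS **`finrank_alg_eq_mul_of_crt`** (`e` by value) and **`finrank_alg_eq_mul_of_sup_eq_top`** (`𝔞 ⊔ 𝔟 = ⊤`):
  `Module.finrank k (Alg K) = Module.finrank k (Alg K𝔞) * Module.finrank k (Alg K𝔟)`.

## References
* [Tate1967] J. T. Tate, *p-divisible groups*, Proc. Conf. Local Fields (Driebergen 1966), Springer 1967 — §2.2.
* [Tate1997FiniteFlatGroupSchemes] J. Tate, *Finite flat group schemes*, in: Modular Forms and Fermat's Last Theorem (1997) — (1.6)–(1.7) (p. 122), §(3.7) (p. 146).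
* [Neukirch1999] J. Neukirch, *Algebraic Number Theory* (1999) — Ch. I §3 (3.6) (Chinese remainder theorem).
* [GortzWedhorn2020] U. Görtz, T. Wedhorn, *Algebraic Geometry I*, 2nd ed. (2020) — Definition 4.45 (2) (p. 117).
* [Waterhouse1979] W. C. Waterhouse, *Introduction to Affine Group Schemes*, GTM 66 (1979) — §14.1.
-/

set_option autoImplicit false

-- Mathlib's `Over`/`Scheme` APIs are stated across semireducible wrappers (as in the ★ `GroupSchemes/*` files).
set_option backward.isDefEq.respectTransparency false

noncomputable section

universe u v

open CategoryTheory CategoryTheory.Limits AlgebraicGeometry MonoidalCategory CartesianMonoidalCategory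
open scoped MonObj

namespace Literature.AlgebraicGeometry.GroupSchemes

namespace IdealTorsionCoprimeSplitting

open Literature.AlgebraicGeometry.Motives GroupSchemeKernel AffineGroupScheme

variable {k : Type u} [Field k] {O : Type v} [CommRing O]
variable {K : SchemeOver k} [GrpObj K] (βK : O → (K ⟶ K))

/-! ## §1 Points: `𝔞`-torsion ⟺ fixed by the CRT element, `𝔟`-torsion ⟺ killed by it -/

section Points

variable {𝔞 𝔟 : Ideal O} {e : O}

/-- The CRT element forces coprimality: `e − 1 ∈ 𝔞`, `e ∈ 𝔟` ⟹ `𝔞 ⊔ 𝔟 = ⊤` (`1 = (1 − e) + e`). [cite: Neukirch1999, Ch. I §3 (3.6)] -/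
theorem sup_eq_top_of_crt (he𝔞 : e - 1 ∈ 𝔞) (he𝔟 : e ∈ 𝔟) : 𝔞 ⊔ 𝔟 = ⊤ := by
  rw [Ideal.eq_top_iff_one]
  have h : (1 : O) = -(e - 1) + e := by ring
  rw [h]
  exact Submodule.add_mem_sup (𝔞.neg_mem he𝔞) he𝔟

/-- Conversely `𝔞 ⊔ 𝔟 = ⊤` yields a CRT element `e ≡ 1 (mod 𝔞)`, `e ∈ 𝔟`. [cite: Neukirch1999, Ch. I §3 (3.6)] -/
theorem exists_crt_of_sup_eq_top (h𝔞𝔟 : 𝔞 ⊔ 𝔟 = ⊤) : ∃ e : O, e - 1 ∈ 𝔞 ∧ e ∈ 𝔟 := by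
  obtain ⟨a, ha, b, hb, hab⟩ := Submodule.mem_sup.1 ((Ideal.eq_top_iff_one _).1 h𝔞𝔟)
  refine ⟨b, ?_, hb⟩
  have h : b - 1 = -a := by rw [← hab]; ring
  rw [h]
  exact 𝔞.neg_mem ha

/-- **`𝔞`-TORSION POINTS ARE FIXED BY `βK e`**: if `x ≫ βK a = 1` for all `a ∈ 𝔞` then `x ≫ βK e = x` — `𝟙 = βK 1 = βK (1 − e) · βK e` and `1 − e ∈ 𝔞`.
[cite: Tate1967, §2.2] [cite: Tate1997FiniteFlatGroupSchemes, (1.6)–(1.7) p. 122] -/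
theorem comp_crt_eq_self_of_torsion (hβ1 : βK 1 = 𝟙 K) (hβadd : ∀ a b, βK (a + b) = βK a * βK b) (he𝔞 : e - 1 ∈ 𝔞)
    {T : SchemeOver k} {x : T ⟶ K} (hx : ∀ a ∈ 𝔞, x ≫ βK a = 1) : x ≫ βK e = x := by
  have h1e : (1 : O) - e ∈ 𝔞 := by
    have h : (1 : O) - e = -(e - 1) := by ring
    rw [h]; exact 𝔞.neg_mem he𝔞
  have hdec : 𝟙 K = βK (1 - e) * βK e := by rw [← hβadd, sub_add_cancel, hβ1]
  calc x ≫ βK e = 1 * (x ≫ βK e) := (one_mul _).symm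
    _ = (x ≫ βK (1 - e)) * (x ≫ βK e) := by rw [hx _ h1e]
    _ = x ≫ 𝟙 K := by rw [hdec, MonObj.comp_mul]
    _ = x := Category.comp_id x

variable [∀ a, IsMonHom (βK a)]

omit [∀ a, IsMonHom (βK a)] in
/-- **FIXED POINTS OF `βK e` ARE `𝔞`-TORSION**: if `x ≫ βK e = x` then `x ≫ βK a = 1` for `a ∈ 𝔞` — `βK e ≫ βK a = βK (a e)` and `a e ∈ 𝔞𝔟` kills `K`.
[cite: Tate1967, §2.2] [cite: Tate1997FiniteFlatGroupSchemes, (1.6)–(1.7) p. 122] -/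
theorem torsion_of_comp_crt_eq_self (hβmul : ∀ a b, βK (a * b) = βK b ≫ βK a) (hk : ∀ c ∈ 𝔞 * 𝔟, βK c = 1) (he𝔟 : e ∈ 𝔟)
    {T : SchemeOver k} {x : T ⟶ K} (hx : x ≫ βK e = x) : ∀ a ∈ 𝔞, x ≫ βK a = 1 := by
  intro a ha
  rw [← hx, Category.assoc, ← hβmul, hk _ (Ideal.mul_mem_mul ha he𝔟), MonObj.comp_one]

omit [∀ a, IsMonHom (βK a)] in
/-- **`K[𝔞] = Fix (βK e)` ON POINTS**: `x` is `𝔞`-torsion iff `x ≫ βK e = x`. [cite: Tate1967, §2.2] [cite: Tate1997FiniteFlatGroupSchemes, (1.6)–(1.7) p. 122] -/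
theorem comp_crt_eq_self_iff (hβ1 : βK 1 = 𝟙 K) (hβadd : ∀ a b, βK (a + b) = βK a * βK b) (hβmul : ∀ a b, βK (a * b) = βK b ≫ βK a)
    (hk : ∀ c ∈ 𝔞 * 𝔟, βK c = 1) (he𝔞 : e - 1 ∈ 𝔞) (he𝔟 : e ∈ 𝔟) {T : SchemeOver k} (x : T ⟶ K) :
    x ≫ βK e = x ↔ ∀ a ∈ 𝔞, x ≫ βK a = 1 :=
  ⟨torsion_of_comp_crt_eq_self βK hβmul hk he𝔟, comp_crt_eq_self_of_torsion βK hβ1 hβadd he𝔞⟩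

omit [∀ a, IsMonHom (βK a)] in
/-- `βK e` IS IDEMPOTENT (its tautological point is fixed: `βK e ≫ βK e = βK (e·e)` and `e·e − e = e(e−1) ∈ 𝔟𝔞`). [cite: Tate1967, §2.2] -/
theorem crt_comp_crt (hβadd : ∀ a b, βK (a + b) = βK a * βK b) (hβmul : ∀ a b, βK (a * b) = βK b ≫ βK a) (hk : ∀ c ∈ 𝔞 * 𝔟, βK c = 1)
    (he𝔞 : e - 1 ∈ 𝔞) (he𝔟 : e ∈ 𝔟) : βK e ≫ βK e = βK e := by
  have h : e * e = e + (e - 1) * e := by ring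
  rw [← hβmul, h, hβadd, hk _ (Ideal.mul_mem_mul he𝔞 he𝔟), mul_one]

/-- **POINTS KILLED BY `βK e` ARE `𝔟`-TORSION**: if `x ≫ βK e = 1` then `x ≫ βK b = 1` for `b ∈ 𝔟` — `b = b(1 − e) + b e`, `b(1−e) ∈ 𝔞𝔟` kills `K`, and
`βK (b e) = βK e ≫ βK b`. [cite: Tate1967, §2.2] [cite: Tate1997FiniteFlatGroupSchemes, (1.6)–(1.7) p. 122] -/
theorem torsion_of_comp_crt_eq_one (hβadd : ∀ a b, βK (a + b) = βK a * βK b) (hβmul : ∀ a b, βK (a * b) = βK b ≫ βK a)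
    (hk : ∀ c ∈ 𝔞 * 𝔟, βK c = 1) (he𝔞 : e - 1 ∈ 𝔞) {T : SchemeOver k} {x : T ⟶ K} (hx : x ≫ βK e = 1) : ∀ b ∈ 𝔟, x ≫ βK b = 1 := by
  intro b hb
  have h1e : (1 : O) - e ∈ 𝔞 := by
    have h : (1 : O) - e = -(e - 1) := by ring
    rw [h]; exact 𝔞.neg_mem he𝔞
  have hdec : βK b = βK ((1 - e) * b) * (βK e ≫ βK b) := by
    rw [← hβmul, ← hβadd]; congr 1; ring
  rw [hdec, MonObj.comp_mul, hk _ (Ideal.mul_mem_mul h1e hb), MonObj.comp_one, ← Category.assoc, hx, MonObj.one_comp, mul_one]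

/-- **`K[𝔟] = Ker (βK e)` ON POINTS**: `x` is `𝔟`-torsion iff `x ≫ βK e = 1`. [cite: Tate1967, §2.2] [cite: Tate1997FiniteFlatGroupSchemes, (1.6)–(1.7) p. 122] -/
theorem comp_crt_eq_one_iff (hβadd : ∀ a b, βK (a + b) = βK a * βK b) (hβmul : ∀ a b, βK (a * b) = βK b ≫ βK a)
    (hk : ∀ c ∈ 𝔞 * 𝔟, βK c = 1) (he𝔞 : e - 1 ∈ 𝔞) (he𝔟 : e ∈ 𝔟) {T : SchemeOver k} (x : T ⟶ K) :
    x ≫ βK e = 1 ↔ ∀ b ∈ 𝔟, x ≫ βK b = 1 :=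
  ⟨torsion_of_comp_crt_eq_one βK hβadd hβmul hk he𝔞, fun hx => hx e he𝔟⟩

end Points

/-! ## §2 The projection `π : K → K[𝔞]`, split by `ι𝔞`, and its kernel `≅ K[𝔟]` -/

section Projection

variable [∀ a, IsMonHom (βK a)] {𝔞 𝔟 : Ideal O} {e : O}
  {K𝔞 : SchemeOver k} (ι𝔞 : K𝔞 ⟶ K)
  (h𝔞 : ∀ ⦃T : SchemeOver k⦄ (x : T ⟶ K), (∃ s : T ⟶ K𝔞, s ≫ ι𝔞 = x) ↔ ∀ a ∈ 𝔞, x ≫ βK a = 1)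

omit [∀ a, IsMonHom (βK a)] in
include h𝔞 in
/-- **THE PROJECTION EXISTS**: `βK e` factors through `K[𝔞]` — `∃ π : K ⟶ K[𝔞], π ≫ ι𝔞 = βK e` (the tautological point `βK e` is `𝔞`-torsion:
`βK e ≫ βK a = βK (a e)`, `a e ∈ 𝔞𝔟`). [cite: Tate1967, §2.2] [cite: GortzWedhorn2020, Definition 4.45 (2) (p. 117)] -/
theorem exists_proj (hβmul : ∀ a b, βK (a * b) = βK b ≫ βK a) (hk : ∀ c ∈ 𝔞 * 𝔟, βK c = 1) (he𝔟 : e ∈ 𝔟) :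
    ∃ π : K ⟶ K𝔞, π ≫ ι𝔞 = βK e :=
  (h𝔞 (βK e)).2 fun a ha => by rw [← hβmul, hk _ (Ideal.mul_mem_mul ha he𝔟)]

omit [∀ a, IsMonHom (βK a)] in
include h𝔞 in
/-- `K[𝔞]` is fixed by `βK e`: `ι𝔞 ≫ βK e = ι𝔞` (its tautological point is `𝔞`-torsion). [cite: Tate1967, §2.2] -/
theorem ι_comp_crt (hβ1 : βK 1 = 𝟙 K) (hβadd : ∀ a b, βK (a + b) = βK a * βK b) (he𝔞 : e - 1 ∈ 𝔞) : ι𝔞 ≫ βK e = ι𝔞 :=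
  comp_crt_eq_self_of_torsion βK hβ1 hβadd he𝔞 ((h𝔞 ι𝔞).1 ⟨𝟙 _, Category.id_comp _⟩)

variable [Mono ι𝔞] {π : K ⟶ K𝔞} (hπ : π ≫ ι𝔞 = βK e)

omit [∀ a, IsMonHom (βK a)] in
include h𝔞 hπ in
/-- **`π` IS SPLIT BY `ι𝔞`**: `ι𝔞 ≫ π = 𝟙` (test after the monomorphism `ι𝔞`). [cite: Tate1967, §2.2] [cite: GortzWedhorn2020, Definition 4.45 (2) (p. 117)] -/
theorem ι_comp_proj (hβ1 : βK 1 = 𝟙 K) (hβadd : ∀ a b, βK (a + b) = βK a * βK b) (he𝔞 : e - 1 ∈ 𝔞) : ι𝔞 ≫ π = 𝟙 K𝔞 := by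
  rw [← cancel_mono ι𝔞, Category.assoc, hπ, ι_comp_crt βK ι𝔞 h𝔞 hβ1 hβadd he𝔞, Category.id_comp]

omit [CommRing O] in
include hπ in
/-- `π` is a homomorphism (`π ≫ ι𝔞 = βK e` is one and `ι𝔞` is a monomorphic homomorphism, ★ `isMonHom_of_comp_mono`).
[cite: GortzWedhorn2020, Definition 4.45 (2) (p. 117)] -/
theorem isMonHom_proj [GrpObj K𝔞] [IsMonHom ι𝔞] : IsMonHom π := by
  haveI : IsMonHom (π ≫ ι𝔞) := by rw [hπ]; infer_instance
  exact isMonHom_of_comp_mono π ι𝔞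

omit [∀ a, IsMonHom (βK a)] in
include h𝔞 hπ in
/-- **`π` IS fppf-LIFTABLE WITHOUT A COVER**: every `T`-point `d` of `K[𝔞]` lifts to `K` along `π` (take `d ≫ ι𝔞`; `ι𝔞 ≫ π = 𝟙`) — the hypothesis of ★
`finrank_alg_eq_ker_mul_of_liftable` with `t = 𝟙`. [cite: Waterhouse1979, §14.1] [cite: GortzWedhorn2020, Definition 4.45 (2) (p. 117)] -/
theorem liftable_proj (hβ1 : βK 1 = 𝟙 K) (hβadd : ∀ a b, βK (a + b) = βK a * βK b) (he𝔞 : e - 1 ∈ 𝔞) ⦃T : SchemeOver k⦄ (d : T ⟶ K𝔞) :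
    ∃ (T' : SchemeOver k) (t : T' ⟶ T) (_ : Epi t.left) (x : T' ⟶ K), x ≫ π = t ≫ d := by
  haveI : Epi (𝟙 T : T ⟶ T).left := by rw [Over.id_left]; infer_instance
  exact ⟨T, 𝟙 T, inferInstance, d ≫ ι𝔞, by rw [Category.assoc, ι_comp_proj βK ι𝔞 h𝔞 hπ hβ1 hβadd he𝔞, Category.comp_id, Category.id_comp]⟩

include hπ in
/-- **THE KERNEL OF `π` ON POINTS**: `y ≫ π = 1` iff `y` is `𝔟`-torsion (`y ≫ π = 1 ⟺ y ≫ βK e = 1`, test after the monomorphic homomorphism `ι𝔞`; then §1).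
[cite: Tate1967, §2.2] [cite: Tate1997FiniteFlatGroupSchemes, (1.6)–(1.7) p. 122] -/
theorem comp_proj_eq_one_iff [GrpObj K𝔞] [IsMonHom ι𝔞] (hβadd : ∀ a b, βK (a + b) = βK a * βK b) (hβmul : ∀ a b, βK (a * b) = βK b ≫ βK a)
    (hk : ∀ c ∈ 𝔞 * 𝔟, βK c = 1) (he𝔞 : e - 1 ∈ 𝔞) (he𝔟 : e ∈ 𝔟) {T : SchemeOver k} (y : T ⟶ K) :
    y ≫ π = 1 ↔ ∀ b ∈ 𝔟, y ≫ βK b = 1 := by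
  rw [← comp_crt_eq_one_iff βK hβadd hβmul hk he𝔞 he𝔟, ← hπ, ← Category.assoc]
  constructor
  · intro h; rw [h, MonObj.one_comp]
  · intro h; rw [← cancel_mono ι𝔞, h, MonObj.one_comp]

variable {K𝔟 : SchemeOver k} (ι𝔟 : K𝔟 ⟶ K) [Mono ι𝔟]
  (h𝔟 : ∀ ⦃T : SchemeOver k⦄ (x : T ⟶ K), (∃ s : T ⟶ K𝔟, s ≫ ι𝔟 = x) ↔ ∀ b ∈ 𝔟, x ≫ βK b = 1)

include hπ h𝔟 in
/-- **`Ker π ≅ K[𝔟]`** over `K`: both are monomorphisms into `K` with the same `T`-points (★ `exists_comp_kerι_eq_iff`, §1), hence mutually factor (★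
`exists_iso_of_fac_of_fac`). [cite: GortzWedhorn2020, Definition 4.45 (2) (p. 117)] [cite: Tate1997FiniteFlatGroupSchemes, (1.6)–(1.7) p. 122] -/
theorem exists_iso_ker_proj [GrpObj K𝔞] [IsMonHom ι𝔞] (hβadd : ∀ a b, βK (a + b) = βK a * βK b) (hβmul : ∀ a b, βK (a * b) = βK b ≫ βK a)
    (hk : ∀ c ∈ 𝔞 * 𝔟, βK c = 1) (he𝔞 : e - 1 ∈ 𝔞) (he𝔟 : e ∈ 𝔟) :
    ∃ ε : ker π ≅ K𝔟, ε.hom ≫ ι𝔟 = kerι π ∧ ε.inv ≫ kerι π = ι𝔟 := by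
  haveI := mono_kerι π
  -- `kerι π` is `𝔟`-torsion, so factors through `ι𝔟`
  obtain ⟨u, hu⟩ := (h𝔟 (kerι π)).2
    ((comp_proj_eq_one_iff βK ι𝔞 hπ hβadd hβmul hk he𝔞 he𝔟 (kerι π)).1 (kerι_comp π))
  -- `ι𝔟` is killed by `π`, so factors through `kerι π`
  have hι𝔟 : ι𝔟 ≫ π = 1 :=
    (comp_proj_eq_one_iff βK ι𝔞 hπ hβadd hβmul hk he𝔞 he𝔟 ι𝔟).2 ((h𝔟 ι𝔟).1 ⟨𝟙 _, Category.id_comp _⟩)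
  exact exists_iso_of_fac_of_fac (kerι π) ι𝔟 u hu (kerLift ι𝔟 hι𝔟) (kerLift_ι ι𝔟 hι𝔟)

end Projection

/-! ## §3 The rank splits: `rk Γ(K) = rk Γ(K[𝔞]) · rk Γ(K[𝔟])` -/

section Rank

variable [∀ a, IsMonHom (βK a)] [IsAffine K.left] [Module.Finite k (Alg K)] {𝔞 𝔟 : Ideal O}
  {K𝔞 : SchemeOver k} [GrpObj K𝔞] [IsAffine K𝔞.left] (ι𝔞 : K𝔞 ⟶ K) [IsMonHom ι𝔞] [Mono ι𝔞]
  (h𝔞 : ∀ ⦃T : SchemeOver k⦄ (x : T ⟶ K), (∃ s : T ⟶ K𝔞, s ≫ ι𝔞 = x) ↔ ∀ a ∈ 𝔞, x ≫ βK a = 1)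
  {K𝔟 : SchemeOver k} (ι𝔟 : K𝔟 ⟶ K) [Mono ι𝔟]
  (h𝔟 : ∀ ⦃T : SchemeOver k⦄ (x : T ⟶ K), (∃ s : T ⟶ K𝔟, s ≫ ι𝔟 = x) ↔ ∀ b ∈ 𝔟, x ≫ βK b = 1)

include h𝔞 h𝔟 in
/-- **COPRIME SPLITTING OF THE RANK, CRT ELEMENT BY VALUE**: for an affine `k`-group scheme `K` with `Γ(K)` finite, an `O`-action `βK` (unital, additive,
anti-multiplicative), ideals `𝔞 𝔟` with `𝔞𝔟` killing `K` and a CRT element `e ≡ 1 (𝔞)`, `e ∈ 𝔟`, the closed subgroups `K[𝔞]`, `K[𝔟]` (given by their points laws)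
satisfy `rk Γ(K) = rk Γ(K[𝔞]) · rk Γ(K[𝔟])` — the kernel–rank law (★ `finrank_alg_eq_ker_mul_of_liftable`) for the split projection `π : K ↠ K[𝔞]` whose kernel is
`K[𝔟]`. [cite: Tate1997FiniteFlatGroupSchemes, §(3.7) (p. 146)] [cite: Tate1967, §2.2] [cite: Waterhouse1979, §14.1] -/
theorem finrank_alg_eq_mul_of_crt (hβ1 : βK 1 = 𝟙 K) (hβadd : ∀ a b, βK (a + b) = βK a * βK b) (hβmul : ∀ a b, βK (a * b) = βK b ≫ βK a)
    (hk : ∀ c ∈ 𝔞 * 𝔟, βK c = 1) {e : O} (he𝔞 : e - 1 ∈ 𝔞) (he𝔟 : e ∈ 𝔟) :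
    Module.finrank k (Alg K) = Module.finrank k (Alg K𝔞) * Module.finrank k (Alg K𝔟) := by
  obtain ⟨π, hπ⟩ := exists_proj βK ι𝔞 h𝔞 hβmul hk he𝔟
  haveI : IsMonHom π := isMonHom_proj βK ι𝔞 hπ
  obtain ⟨ε, -, -⟩ := exists_iso_ker_proj βK ι𝔞 hπ ι𝔟 h𝔟 hβadd hβmul hk he𝔞 he𝔟
  rw [finrank_alg_eq_ker_mul_of_liftable π (liftable_proj βK ι𝔞 h𝔞 hπ hβ1 hβadd he𝔞), Alg.finrank_eq_of_iso ε, mul_comm]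

include h𝔞 h𝔟 in
/-- **COPRIME SPLITTING OF THE RANK**: `𝔞 ⊔ 𝔟 = ⊤` and `𝔞𝔟` kills `K` ⟹ `rk Γ(K) = rk Γ(K[𝔞]) · rk Γ(K[𝔟])` (a CRT element exists, ★ `exists_crt_of_sup_eq_top`;
then `finrank_alg_eq_mul_of_crt`).  L3 reads it with `K := Ker q̄ ↪ A_x̄`, `𝔞 := 𝔭_w`, `𝔟 := 𝔭_{c•w}` (`w ≠ c•w`), hker-DOWN «`Ker q̄` is killed by `𝔭_w·𝔭_{c•w}`» as `hk`.
[cite: Tate1997FiniteFlatGroupSchemes, §(3.7) (p. 146)] [cite: Tate1967, §2.2] [cite: Neukirch1999, Ch. I §3 (3.6)] -/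
theorem finrank_alg_eq_mul_of_sup_eq_top (hβ1 : βK 1 = 𝟙 K) (hβadd : ∀ a b, βK (a + b) = βK a * βK b)
    (hβmul : ∀ a b, βK (a * b) = βK b ≫ βK a) (h𝔞𝔟 : 𝔞 ⊔ 𝔟 = ⊤) (hk : ∀ c ∈ 𝔞 * 𝔟, βK c = 1) :
    Module.finrank k (Alg K) = Module.finrank k (Alg K𝔞) * Module.finrank k (Alg K𝔟) := by
  obtain ⟨e, he𝔞, he𝔟⟩ := exists_crt_of_sup_eq_top h𝔞𝔟
  exact finrank_alg_eq_mul_of_crt βK ι𝔞 h𝔞 ι𝔟 h𝔟 hβ1 hβadd hβmul hk he𝔞 he𝔟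

end Rank

end IdealTorsionCoprimeSplitting

end Literature.AlgebraicGeometry.GroupSchemes
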